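import Summits.BirchSwinnertonDyer.BirchSwinnertonDyer.Theorems.EisensteinPrimesBSDpOnCellCTelescopeBranchReflexiveHullFree
import Summits.BirchSwinnertonDyer.BirchSwinnertonDyer.Theorems.EisensteinPrimesBSDpOnCellCTelescopeBranchTraceInterpolation
import Literature.NumberTheory.GaloisRepresentations.ContinuousRep
import HarnessLib

/-!
# [telescope — width x2-p2 g25, 2026-08-30] Brick G3 of «(F) CONSTRUCTED IN TREE»: an INTEGRAL CONTINUOUS FRAME for Wiles'
representation over `Frac ℤ_p⟦X⟧`, by divisorial rescaling

Crux 4 `BSDpOnCellC` (stmt-BirchSwinnertonDyer-19034), line «telescope» v19; ʳ-chain (director (610); host map STATUS l.7169 / l.7197 (b);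
LEAD g7 `RCHAIN-SPEC-g7.md` §4–§5). Wiles' lemma (B1 `WilesPseudoRep.exists_rep_fractionRing`, p778720) turns the glued pseudo-representation
`{a, d, x}` over `Λ = ℤ_p⟦X⟧` into `ρ : G →* M₂(Frac Λ)` with entries `a(g)`, `b(g) = x(g,s₀)/x₀`, `c(g) = x(r₀,g)`, `d(g)`, where `x₀ = x(r₀,s₀) ≠ 0`,
`x₀·b(g) ∈ Λ`, `b(g)c(h) = x(g,h) ∈ Λ`. (F) asks for a framed CONTINUOUS `π : G →ₜ* GL₂(Λ)`; this file builds it by a diagonal change of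
frame `diag(β, 1)` instead of the SPEC's reflexive-hull lattice:
* §1 `exists_common_scaling` — over a domain `R` whose ideals have FREE duals (for `R = 𝒪⟦X⟧`, `𝒪` a local PID: x2-p2 g24's
  `TelescopeBranchReflexiveHullFree.free_dual_powerSeries`, p777520), a family `b : ι → K = Frac R` with a common denominator admits
  `β ∈ Kˣ` with `b(i) ∈ Rβ` and `β·C ⊆ R`, `C = {y : y·b(i) ∈ R ∀ i}` (`β` generates `(R : C) ≅ Hom_R(C, R)`, free inside `K`, hence cyclic);
* §2 `exists_integral_conj` — so `π(g) := diag(β,1)⁻¹ρ(g)diag(β,1) = (a, b/β; βc, d)` is an `M₂(R)`-valued monoid homomorphism; its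
  `charpoly`/`trace`/`det`/kernel are those of `ρ` (`charpoly_map_eq_of_map_eq_units_conj`, …);
* §3 `continuous_of_continuous_const_mul` — in a COMPACT Hausdorff domain, continuity passes from `w·f` to `f` (`w ≠ 0`);
* §4 `exists_framedRep_of_rep_fractionRing` — the packaged brick: a continuous `π : FramedRep G R 2` with
  `(π g).map (algebraMap R K) = U⁻¹ ρ(g) U` for one `U ∈ GL₂(K)`; §5 `exists_framedRep_powerSeries_padicInt` — the instance `R = ℤ_p⟦X⟧`.

Helper toward crux 4 (`--supports`); closes NO registered stub, proves no cited fact and no summit statement; BSD is proved for no curve.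
-/

set_option autoImplicit false
set_option linter.dupNamespace false

open Matrix
open scoped PowerSeries.WithPiTopology

namespace Summit.BirchSwinnertonDyer.BirchSwinnertonDyer.Theorems.TelescopeBranchIntegralFrame

/-! ### §1. Divisorial rescaling of a family with a common denominator -/

section Scaling

variable {R : Type*} [CommRing R] [IsDomain R] {K : Type*} [Field K] [Algebra R K] [IsFractionRing R K]

/-- **A free `R`-submodule of `Frac R` is cyclic**: two distinct basis vectors of a submodule of `K = Frac R` would be `R`-linearly
dependent after clearing denominators. [folklore] -/
theorem subsingleton_basis_index_of_submodule_fractionRing {B : Submodule R K} {ι' : Type*} (bB : Module.Basis ι' R B) :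
    Subsingleton ι' := by
  refine ⟨fun i j => ?_⟩
  have hi0 : ((bB i : B) : K) ≠ 0 := fun h => bB.ne_zero i (Subtype.ext h)
  have hj0 : ((bB j : B) : K) ≠ 0 := fun h => bB.ne_zero j (Subtype.ext h)
  obtain ⟨xi, yi, hyi, hvi⟩ := IsFractionRing.div_surjective (A := R) ((bB i : B) : K)
  obtain ⟨xj, yj, hyj, hvj⟩ := IsFractionRing.div_surjective (A := R) ((bB j : B) : K)
  have hyi0 : algebraMap R K yi ≠ 0 := IsFractionRing.to_map_ne_zero_of_mem_nonZeroDivisors hyi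
  have hyj0 : algebraMap R K yj ≠ 0 := IsFractionRing.to_map_ne_zero_of_mem_nonZeroDivisors hyj
  have hxi0 : xi ≠ 0 := by rintro rfl; rw [map_zero, zero_div] at hvi; exact hi0 hvi.symm
  have hxj0 : xj ≠ 0 := by rintro rfl; rw [map_zero, zero_div] at hvj; exact hj0 hvj.symm
  refine bB.linearIndependent.eq_of_smul_apply_eq_smul_apply (xj * yi) (xi * yj) i j
    (mul_ne_zero hxj0 (nonZeroDivisors.ne_zero hyi)) ?_
  apply Subtype.ext
  rw [Submodule.coe_smul, Submodule.coe_smul, Algebra.smul_def, Algebra.smul_def, ← hvi, ← hvj, map_mul, map_mul]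
  field_simp

/-- A free `R`-submodule of `Frac R` containing `1` is generated by one non-zero element. [folklore] -/
theorem exists_eq_span_singleton_of_free {B : Submodule R K} [Module.Free R B] (h1 : (1 : K) ∈ B) :
    ∃ β : K, β ≠ 0 ∧ β ∈ B ∧ ∀ z ∈ B, ∃ r : R, z = algebraMap R K r * β := by
  classical
  set bB := Module.Free.chooseBasis R B
  haveI : Subsingleton (Module.Free.ChooseBasisIndex R B) := subsingleton_basis_index_of_submodule_fractionRing bB
  -- the basis is non-empty since `1 ∈ B` is non-zero
  have hne : ((bB.repr ⟨1, h1⟩).support).Nonempty := by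
    rw [Finset.nonempty_iff_ne_empty, Ne, Finsupp.support_eq_empty, LinearEquiv.map_eq_zero_iff]
    intro h
    exact one_ne_zero (congrArg Subtype.val h : ((⟨1, h1⟩ : B) : K) = 0)
  obtain ⟨i₀, -⟩ := hne
  refine ⟨(bB i₀ : B), fun h => bB.ne_zero i₀ (Subtype.ext h), (bB i₀).2, fun z hz => ?_⟩
  have hmem := bB.mem_span_repr_support ⟨z, hz⟩
  have hsub : (bB '' ((bB.repr ⟨z, hz⟩).support : Set _)) ⊆ {bB i₀} := by
    rintro _ ⟨i, -, rfl⟩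
    rw [Set.mem_singleton_iff, Subsingleton.elim i i₀]
  have hmem' : (⟨z, hz⟩ : B) ∈ Submodule.span R {bB i₀} := Submodule.span_mono hsub hmem
  obtain ⟨r, hr⟩ := Submodule.mem_span_singleton.mp hmem'
  exact ⟨r, by have := congrArg Subtype.val hr; rw [Submodule.coe_smul, Algebra.smul_def] at this; exact this.symm⟩

/-- **Divisorial rescaling.** Let `R` be a domain with fraction field `K` such that the dual `Hom_R(C, R)` of every ideal `C` is a free
`R`-module (e.g. `R = 𝒪⟦X⟧`, `𝒪` a local PID: `TelescopeBranchReflexiveHullFree.free_dual_powerSeries`). If `b : ι → K` has a common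
denominator `x₀ ≠ 0` (`x₀ b(i) ∈ R`), then there is `β ∈ Kˣ` with `b(i) ∈ R·β` for all `i` and `β·y ∈ R` for every `y` in the conductor
`C = {y ∈ R : y b(i) ∈ R ∀ i}`. (`β` generates `(R : C)`, which is isomorphic to `Hom_R(C, R)` — free — and lies in `K`, hence is cyclic.)
[folklore; cf. Bourbaki, *Commutative Algebra* VII §1 (divisorial ideals)] -/
theorem exists_common_scaling (hfree : ∀ C : Ideal R, Module.Free R (Module.Dual R C)) {ι : Type*} (b : ι → K) (x₀ : R)
    (hx₀ : x₀ ≠ 0) (hb : ∀ i, ∃ r : R, algebraMap R K x₀ * b i = algebraMap R K r) :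
    ∃ β : K, β ≠ 0 ∧ (∀ i, ∃ r : R, b i = algebraMap R K r * β) ∧
      ∀ y : R, (∀ i, ∃ r : R, algebraMap R K y * b i = algebraMap R K r) →
        ∃ s : R, β * algebraMap R K y = algebraMap R K s := by
  classical
  have hinj : Function.Injective (algebraMap R K) := IsFractionRing.injective R K
  have hx₀K : algebraMap R K x₀ ≠ 0 := fun h => hx₀ (hinj (by rw [h, map_zero]))
  -- the conductor ideal `C`
  let C : Ideal R :=
    { carrier := {y | ∀ i, ∃ r : R, algebraMap R K y * b i = algebraMap R K r}
      zero_mem' := fun i => ⟨0, by simp⟩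
      add_mem' := fun {y y'} hy hy' i => by
        obtain ⟨r, hr⟩ := hy i
        obtain ⟨r', hr'⟩ := hy' i
        exact ⟨r + r', by rw [map_add, add_mul, hr, hr', map_add]⟩
      smul_mem' := fun t {y} hy i => by
        obtain ⟨r, hr⟩ := hy i
        exact ⟨t * r, by rw [smul_eq_mul, map_mul, mul_assoc, hr, map_mul]⟩ }
  have hx₀C : x₀ ∈ C := hb
  -- its `R`-dual inside `K`: `Bt = (R : C)`
  let Bt : Submodule R K :=
    { carrier := {z | ∀ y ∈ C, ∃ s : R, algebraMap R K y * z = algebraMap R K s}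
      zero_mem' := fun y _ => ⟨0, by simp⟩
      add_mem' := fun {z z'} hz hz' y hy => by
        obtain ⟨s, hs⟩ := hz y hy
        obtain ⟨s', hs'⟩ := hz' y hy
        exact ⟨s + s', by rw [mul_add, hs, hs', map_add]⟩
      smul_mem' := fun t {z} hz y hy => by
        obtain ⟨s, hs⟩ := hz y hy
        exact ⟨t * s, by rw [Algebra.smul_def, mul_left_comm, hs, map_mul]⟩ }
  have hbBt : ∀ i, b i ∈ Bt := fun i y hy => hy i
  have h1Bt : (1 : K) ∈ Bt := fun y _ => ⟨y, by rw [mul_one]⟩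
  -- `Bt ≅ Hom_R(C, R)` via `f ↦ f(x₀)/x₀`
  have key : ∀ (f : Module.Dual R C) (y : C),
      algebraMap R K (f y) * algebraMap R K x₀ = algebraMap R K (y : R) * algebraMap R K (f ⟨x₀, hx₀C⟩) := by
    intro f y
    have e : (x₀ • y : C) = ((y : R) • ⟨x₀, hx₀C⟩ : C) := by
      apply Subtype.ext
      change x₀ • (y : R) = (y : R) • x₀
      rw [smul_eq_mul, smul_eq_mul, mul_comm]
    have := congrArg f e
    rw [map_smul, map_smul, smul_eq_mul, smul_eq_mul] at this
    rw [← map_mul, ← map_mul, mul_comm (f y), this]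
  let Ψ : Module.Dual R C →ₗ[R] K :=
    { toFun := fun f => algebraMap R K (f ⟨x₀, hx₀C⟩) / algebraMap R K x₀
      map_add' := fun f f' => by rw [LinearMap.add_apply, map_add, add_div]
      map_smul' := fun t f => by
        rw [LinearMap.smul_apply, smul_eq_mul, map_mul, RingHom.id_apply, Algebra.smul_def, mul_div_assoc] }
  have hΨ : ∀ f, Ψ f = algebraMap R K (f ⟨x₀, hx₀C⟩) / algebraMap R K x₀ := fun f => rfl
  have hΨval : ∀ (f : Module.Dual R C) (y : C), algebraMap R K (y : R) * Ψ f = algebraMap R K (f y) := by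
    intro f y
    rw [hΨ, mul_div_assoc', ← key f y, mul_div_assoc, div_self hx₀K, mul_one]
  have hΨmem : ∀ f, Ψ f ∈ Bt := fun f y hy => ⟨f ⟨y, hy⟩, hΨval f ⟨y, hy⟩⟩
  have hΨinj : Function.Injective Ψ := by
    rw [injective_iff_map_eq_zero]
    intro f hf
    have hf0 : f ⟨x₀, hx₀C⟩ = 0 := by
      rw [hΨ, div_eq_zero_iff] at hf; exact hinj (by rw [map_zero]; exact hf.resolve_right hx₀K)
    refine LinearMap.ext fun y => hinj ?_
    have := key f y
    rw [hf0, map_zero, mul_zero, mul_eq_zero] at this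
    rw [LinearMap.zero_apply, map_zero]
    exact this.resolve_right hx₀K
  have hΨsurj : ∀ z ∈ Bt, ∃ f, Ψ f = z := by
    intro z hz
    choose s hs using hz
    let f : Module.Dual R C :=
      { toFun := fun y => s y y.2
        map_add' := fun y y' => hinj (by
          rw [map_add, ← hs, ← hs, ← hs, Submodule.coe_add, map_add, add_mul])
        map_smul' := fun t y => hinj (by
          rw [RingHom.id_apply, smul_eq_mul, map_mul, ← hs, ← hs, Submodule.coe_smul, smul_eq_mul, map_mul, mul_assoc]) }
    refine ⟨f, ?_⟩
    rw [hΨ, div_eq_iff hx₀K, mul_comm]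
    exact (hs x₀ hx₀C).symm
  let e : Module.Dual R C ≃ₗ[R] Bt :=
    LinearEquiv.ofBijective (LinearMap.codRestrict Bt Ψ hΨmem)
      ⟨fun f f' h => hΨinj (congrArg Subtype.val h), fun ⟨z, hz⟩ => by
        obtain ⟨f, hf⟩ := hΨsurj z hz
        exact ⟨f, Subtype.ext hf⟩⟩
  haveI : Module.Free R Bt := Module.Free.of_equiv e
  obtain ⟨β, hβ0, hβBt, hgen⟩ := exists_eq_span_singleton_of_free (R := R) (K := K) h1Bt
  refine ⟨β, hβ0, fun i => hgen (b i) (hbBt i), fun y hy => ?_⟩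
  obtain ⟨s, hs⟩ := hβBt y hy
  exact ⟨s, by rw [mul_comm, hs]⟩

end Scaling

/-! ### §2. The integral conjugate `diag(β,1)⁻¹ ρ diag(β,1)` -/

section Integral

variable {R : Type*} [CommRing R] [IsDomain R] {K : Type*} [Field K] [Algebra R K] [IsFractionRing R K]

/-- The diagonal change of frame `diag(β, 1)` as a unit of `M₂(K)` (`β ≠ 0`). [folklore] -/
theorem exists_units_diag (β : K) (hβ : β ≠ 0) :
    ∃ U : (Matrix (Fin 2) (Fin 2) K)ˣ, (U : Matrix (Fin 2) (Fin 2) K) = !![β, 0; 0, 1] ∧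
      (↑U⁻¹ : Matrix (Fin 2) (Fin 2) K) = !![β⁻¹, 0; 0, 1] := by
  refine ⟨⟨!![β, 0; 0, 1], !![β⁻¹, 0; 0, 1], ?_, ?_⟩, rfl, rfl⟩ <;>
  · ext i j; fin_cases i <;> fin_cases j <;> simp [Matrix.mul_apply, Fin.sum_univ_two, hβ]

/-- Entrywise form of `diag(β,1)⁻¹ N diag(β,1) = (N₀₀, β⁻¹N₀₁; βN₁₀, N₁₁)` (`β ≠ 0`). [folklore] -/
theorem diag_inv_mul_mul_diag (β : K) (hβ : β ≠ 0) (N : Matrix (Fin 2) (Fin 2) K) :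
    !![β⁻¹, 0; 0, 1] * N * !![β, 0; 0, 1] = !![N 0 0, β⁻¹ * N 0 1; N 1 0 * β, N 1 1] := by
  conv_lhs => rw [Matrix.eta_fin_two N]
  rw [Matrix.mul_fin_two, Matrix.mul_fin_two]
  ext i j; fin_cases i <;> fin_cases j <;> simp
  rw [mul_assoc, mul_comm (N 0 0), ← mul_assoc, inv_mul_cancel₀ hβ, one_mul]

/-- **The integral conjugate of Wiles' representation.** Let `R` be a domain with fraction field `K` whose ideals have free duals, and
`ρ : G →* M₂(K)` a monoid homomorphism with `ρ(g)₀₀ = a(g)`, `ρ(g)₁₁ = d(g)`, `ρ(g)₁₀ = c(g)` in `R`, `x₀·ρ(g)₀₁ = b'(g) ∈ R` for one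
`x₀ ≠ 0`, and `ρ(g)₀₁ρ(h)₁₀ ∈ R` (for Wiles' `toRep` over `Frac Λ`: `x₀ = x(r₀,s₀)`, `b' = x(·,s₀)`, `c = x(r₀,·)`, `ρ(g)₀₁ρ(h)₁₀ = x(g,h)`
by (W3)). Then for a suitable `β = n/m ∈ Kˣ` the conjugate `π(g) = diag(β,1)⁻¹ρ(g)diag(β,1)` is a monoid homomorphism `G →* M₂(R)` with
`π₀₀ = a`, `π₁₁ = d`, `(n x₀)·π₀₁ = m·b'`, `m·π₁₀ = n·c`. [folklore; replaces the reflexive-hull lattice of Hida 1986 §2 / Wiles 1988 §2.2] -/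
theorem exists_integral_conj (hfree : ∀ C : Ideal R, Module.Free R (Module.Dual R C)) {G : Type*} [Monoid G]
    (ρ : G →* Matrix (Fin 2) (Fin 2) K) (x₀ : R) (hx₀ : x₀ ≠ 0) (a d c b' : G → R)
    (ha : ∀ g, ρ g 0 0 = algebraMap R K (a g)) (hd : ∀ g, ρ g 1 1 = algebraMap R K (d g))
    (hc : ∀ g, ρ g 1 0 = algebraMap R K (c g)) (hb' : ∀ g, algebraMap R K x₀ * ρ g 0 1 = algebraMap R K (b' g))
    (hx : ∀ g h, ∃ r : R, ρ g 0 1 * ρ h 1 0 = algebraMap R K r) :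
    ∃ (β : K) (n m : R) (π : G →* Matrix (Fin 2) (Fin 2) R), β ≠ 0 ∧ n ≠ 0 ∧ m ≠ 0 ∧
      algebraMap R K n = β * algebraMap R K m ∧
      (∀ g, (π g).map (algebraMap R K) = !![β⁻¹, 0; 0, 1] * ρ g * !![β, 0; 0, 1]) ∧
      (∀ g, π g 0 0 = a g) ∧ (∀ g, π g 1 1 = d g) ∧
      (∀ g, (n * x₀) * π g 0 1 = m * b' g) ∧ (∀ g, m * π g 1 0 = n * c g) := by
  classical
  have hinj : Function.Injective (algebraMap R K) := IsFractionRing.injective R K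
  obtain ⟨β, hβ0, hbβ, hCβ⟩ := exists_common_scaling hfree (fun g => ρ g 0 1) x₀ hx₀ (fun g => ⟨b' g, hb' g⟩)
  choose b'' hb'' using hbβ
  have hcC : ∀ h, ∃ s : R, β * algebraMap R K (c h) = algebraMap R K s := by
    intro h
    refine hCβ (c h) fun g => ?_
    obtain ⟨r, hr⟩ := hx g h
    exact ⟨r, by rw [← hc, mul_comm, hr]⟩
  choose c'' hc'' using hcC
  -- `β = n / m`
  obtain ⟨n, m, hm, hnm⟩ := IsFractionRing.div_surjective (A := R) β
  have hmK : algebraMap R K m ≠ 0 := IsFractionRing.to_map_ne_zero_of_mem_nonZeroDivisors hm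
  have hn0 : n ≠ 0 := by rintro rfl; rw [map_zero, zero_div] at hnm; exact hβ0 hnm.symm
  have hnm' : algebraMap R K n = β * algebraMap R K m := by rw [← hnm, div_mul_cancel₀ _ hmK]
  -- the matrices and the conjugation identity
  let πf : G → Matrix (Fin 2) (Fin 2) R := fun g => !![a g, b'' g; c'' g, d g]
  have hπf : ∀ g, (πf g).map (algebraMap R K) = !![β⁻¹, 0; 0, 1] * ρ g * !![β, 0; 0, 1] := by
    intro g
    have e01 : algebraMap R K (b'' g) = β⁻¹ * ρ g 0 1 := by
      rw [hb'' g, mul_comm _ β, ← mul_assoc, inv_mul_cancel₀ hβ0, one_mul]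
    have e10 : algebraMap R K (c'' g) = ρ g 1 0 * β := by rw [← hc'' g, mul_comm, hc g]
    rw [diag_inv_mul_mul_diag β hβ0]
    ext i j
    fin_cases i <;> fin_cases j <;> simp [πf, ha g, hd g, e01, e10]
  have hmapinj : Function.Injective (fun M : Matrix (Fin 2) (Fin 2) R => M.map (algebraMap R K)) :=
    fun M N h => Matrix.map_injective hinj h
  obtain ⟨U, hU, hUinv⟩ := exists_units_diag β hβ0
  have hπf' : ∀ g, (πf g).map (algebraMap R K) = (↑U⁻¹ : Matrix (Fin 2) (Fin 2) K) * ρ g * (U : Matrix (Fin 2) (Fin 2) K) := by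
    intro g; rw [hπf, hU, hUinv]
  let π : G →* Matrix (Fin 2) (Fin 2) R :=
    { toFun := πf
      map_one' := hmapinj (by
        change (πf 1).map (algebraMap R K) = (1 : Matrix (Fin 2) (Fin 2) R).map (algebraMap R K)
        rw [hπf' 1, map_one, mul_one, Units.inv_mul, Matrix.map_one (algebraMap R K) (map_zero _) (map_one _)])
      map_mul' := fun g h => hmapinj (by
        change (πf (g * h)).map (algebraMap R K) = (πf g * πf h).map (algebraMap R K)
        rw [Matrix.map_mul, hπf', hπf', hπf', map_mul]
        calc (↑U⁻¹ : Matrix (Fin 2) (Fin 2) K) * (ρ g * ρ h) * (U : Matrix (Fin 2) (Fin 2) K)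
            = ↑U⁻¹ * ρ g * ((U : Matrix (Fin 2) (Fin 2) K) * ↑U⁻¹) * ρ h * (U : Matrix (Fin 2) (Fin 2) K) := by
              rw [Units.mul_inv]; simp only [Matrix.mul_assoc, Matrix.one_mul]
          _ = ↑U⁻¹ * ρ g * (U : Matrix (Fin 2) (Fin 2) K) * (↑U⁻¹ * ρ h * (U : Matrix (Fin 2) (Fin 2) K)) := by
              simp only [Matrix.mul_assoc]) }
  refine ⟨β, n, m, π, hβ0, hn0, nonZeroDivisors.ne_zero hm, hnm', hπf, fun g => by simp [π, πf], fun g => by simp [π, πf],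
    fun g => hinj ?_, fun g => hinj ?_⟩
  · -- `(n x₀) b''(g) = m b'(g)`: multiply `b'' β = ρ₀₁` by `x₀ m`
    change algebraMap R K (n * x₀ * b'' g) = algebraMap R K (m * b' g)
    rw [map_mul, map_mul, map_mul, hnm', ← hb' g, hb'' g]
    ring
  · change algebraMap R K (m * c'' g) = algebraMap R K (n * c g)
    rw [map_mul, map_mul, ← hc'' g, hnm']
    ring

omit [IsDomain R] [IsFractionRing R K] in
/-- If `M.map (algebraMap R K) = U⁻¹ N U`, then `charpoly M` maps to `charpoly N`. [folklore] -/
theorem charpoly_map_eq_of_map_eq_units_conj {n : Type*} [Fintype n] [DecidableEq n] (M : Matrix n n R) (N : Matrix n n K)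
    (U : (Matrix n n K)ˣ) (h : M.map (algebraMap R K) = (↑U⁻¹ : Matrix n n K) * N * (U : Matrix n n K)) :
    M.charpoly.map (algebraMap R K) = N.charpoly := by
  rw [← Matrix.charpoly_map, h, Matrix.coe_units_inv, Matrix.charpoly_units_conj']

omit [IsDomain R] [IsFractionRing R K] in
/-- If `M.map (algebraMap R K) = U⁻¹ N U`, then `trace M` maps to `trace N`. [folklore] -/
theorem trace_map_eq_of_map_eq_units_conj {n : Type*} [Fintype n] [DecidableEq n] (M : Matrix n n R) (N : Matrix n n K)
    (U : (Matrix n n K)ˣ) (h : M.map (algebraMap R K) = (↑U⁻¹ : Matrix n n K) * N * (U : Matrix n n K)) :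
    algebraMap R K M.trace = N.trace := by
  have : (M.map (algebraMap R K)).trace = N.trace := by rw [h, Matrix.trace_units_conj']
  rw [← this, Matrix.trace, Matrix.trace, map_sum]
  rfl

omit [IsDomain R] [IsFractionRing R K] in
/-- If `M.map (algebraMap R K) = U⁻¹ N U`, then `det M` maps to `det N`. [folklore] -/
theorem det_map_eq_of_map_eq_units_conj {n : Type*} [Fintype n] [DecidableEq n] (M : Matrix n n R) (N : Matrix n n K)
    (U : (Matrix n n K)ˣ) (h : M.map (algebraMap R K) = (↑U⁻¹ : Matrix n n K) * N * (U : Matrix n n K)) :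
    algebraMap R K M.det = N.det := by
  rw [RingHom.map_det, RingHom.mapMatrix_apply, h, Matrix.det_units_conj']

omit [IsDomain R] in
/-- If `M.map (algebraMap R K) = U⁻¹ N U` and `N = 1`, then `M = 1` (the kernel of the integral frame is that of `ρ`). [folklore] -/
theorem eq_one_of_map_eq_units_conj_one {n : Type*} [Fintype n] [DecidableEq n] (M : Matrix n n R) (N : Matrix n n K)
    (U : (Matrix n n K)ˣ) (h : M.map (algebraMap R K) = (↑U⁻¹ : Matrix n n K) * N * (U : Matrix n n K)) (hN : N = 1) : M = 1 := by
  apply Matrix.map_injective (IsFractionRing.injective R K)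
  change M.map (algebraMap R K) = (1 : Matrix n n R).map (algebraMap R K)
  rw [h, hN, Matrix.mul_one, Units.inv_mul, Matrix.map_one (algebraMap R K) (map_zero _) (map_one _)]

end Integral

/-! ### §3. Continuity through a non-zero scalar in a compact Hausdorff domain -/

section Topology

variable {R : Type*} [CommRing R] [IsDomain R] [TopologicalSpace R] [CompactSpace R] [T2Space R] [ContinuousMul R]

/-- In a compact Hausdorff topological domain, multiplication by `w ≠ 0` is a closed embedding `R ↪ R`. [folklore] -/
theorem isClosedEmbedding_mul_left {w : R} (hw : w ≠ 0) : Topology.IsClosedEmbedding fun r : R => w * r :=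
  (continuous_const.mul continuous_id).isClosedEmbedding (mul_right_injective₀ hw)

/-- **Continuity transfers through a non-zero scalar** `w ≠ 0` of a compact Hausdorff domain (e.g. `ℤ_p⟦X⟧`). [folklore] -/
theorem continuous_of_continuous_const_mul {X : Type*} [TopologicalSpace X] {w : R} (hw : w ≠ 0) (f : X → R)
    (h : Continuous fun x => w * f x) : Continuous f :=
  (isClosedEmbedding_mul_left hw).isEmbedding.continuous_iff.mpr h

end Topology

/-! ### §4. The packaged brick: a continuous integral frame -/

section Frame

open Literature.NumberTheory.GaloisRepresentations

variable {R : Type*} [CommRing R] [IsDomain R] [TopologicalSpace R] [CompactSpace R] [T2Space R] [IsTopologicalRing R]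
  {K : Type*} [Field K] [Algebra R K] [IsFractionRing R K]

/-- **Brick G3 — the integral continuous frame.** `R` a compact Hausdorff topological domain whose ideals have free duals, `K = Frac R`,
`G` a topological group, `ρ : G →* M₂(K)` with `R`-valued CONTINUOUS entries `a, d, c` and upper-right numerator `b' = x₀·ρ₀₁` (`x₀ ≠ 0`),
and `ρ(g)₀₁ρ(h)₁₀ ∈ R` (Wiles' representation over `Frac ℤ_p⟦X⟧`, B1 `exists_rep_fractionRing`): some `GL₂(K)`-conjugate of `ρ` is a
CONTINUOUS framed `π : G →ₜ* GL₂(R)`, `(π g).map (algebraMap R K) = U⁻¹ ρ(g) U`. [folklore; Wiles 1988 §2.2; Hida 1986 §2] -/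
theorem exists_framedRep_of_rep_fractionRing (hfree : ∀ C : Ideal R, Module.Free R (Module.Dual R C))
    {G : Type*} [Group G] [TopologicalSpace G] [IsTopologicalGroup G]
    (ρ : G →* Matrix (Fin 2) (Fin 2) K) (x₀ : R) (hx₀ : x₀ ≠ 0) (a d c b' : G → R)
    (ha : ∀ g, ρ g 0 0 = algebraMap R K (a g)) (hd : ∀ g, ρ g 1 1 = algebraMap R K (d g))
    (hc : ∀ g, ρ g 1 0 = algebraMap R K (c g)) (hb' : ∀ g, algebraMap R K x₀ * ρ g 0 1 = algebraMap R K (b' g))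
    (hx : ∀ g h, ∃ r : R, ρ g 0 1 * ρ h 1 0 = algebraMap R K r)
    (ha_c : Continuous a) (hd_c : Continuous d) (hc_c : Continuous c) (hb'_c : Continuous b') :
    ∃ (π : FramedRep G R 2) (U : (Matrix (Fin 2) (Fin 2) K)ˣ),
      ∀ g, ((π g : GL (Fin 2) R) : Matrix (Fin 2) (Fin 2) R).map (algebraMap R K) = (↑U⁻¹ : Matrix (Fin 2) (Fin 2) K) * ρ g * (U : Matrix (Fin 2) (Fin 2) K) := by
  obtain ⟨β, n, m, π₀, hβ0, hn0, hm0, _hnm, hconj, h00, h11, h01, h10⟩ :=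
    exists_integral_conj hfree ρ x₀ hx₀ a d c b' ha hd hc hb' hx
  obtain ⟨U, hU, hUinv⟩ := exists_units_diag (K := K) β hβ0
  -- continuity of the four entries
  have hπc : Continuous (π₀ : G → Matrix (Fin 2) (Fin 2) R) := by
    refine continuous_matrix fun i j => ?_
    fin_cases i <;> fin_cases j
    · exact ha_c.congr fun g => (h00 g).symm
    · refine continuous_of_continuous_const_mul (mul_ne_zero hn0 hx₀) _ ?_
      exact ((continuous_const (y := m)).mul hb'_c).congr fun g => (h01 g).symm
    · refine continuous_of_continuous_const_mul hm0 _ ?_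
      exact ((continuous_const (y := n)).mul hc_c).congr fun g => (h10 g).symm
    · exact hd_c.congr fun g => (h11 g).symm
  -- into units
  let πu : G →* GL (Fin 2) R := π₀.toHomUnits
  have hπu : Continuous πu := by
    refine Units.continuous_iff.mpr ⟨hπc, ?_⟩
    have e : (fun g => ((πu g)⁻¹ : GL (Fin 2) R).val) = fun g => π₀ g⁻¹ := by
      funext g; rw [← map_inv]; rfl
    change Continuous fun g => ((πu g)⁻¹ : GL (Fin 2) R).val
    rw [e]
    exact hπc.comp continuous_inv
  refine ⟨⟨πu, hπu⟩, U, fun g => ?_⟩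
  change (π₀ g).map (algebraMap R K) = _
  rw [hconj, hU, hUinv]

end Frame

/-! ### §5. The instance `R = ℤ_p⟦X⟧` -/

section PadicInt

open Literature.NumberTheory.GaloisRepresentations PowerSeries

variable {p : ℕ} [Fact p.Prime]

/-- Duals of ideals of `ℤ_p⟦X⟧` are free (x2-p2 g24's `free_dual_powerSeries`, p777520). [cite: BrunsHerzog1998, Prop. 1.4.1] -/
theorem free_dual_ideal_powerSeries_padicInt (C : Ideal (PowerSeries ℤ_[p])) :
    Module.Free (PowerSeries ℤ_[p]) (Module.Dual (PowerSeries ℤ_[p]) C) :=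
  TelescopeBranchReflexiveHullFree.free_dual_powerSeries ℤ_[p] C

/-- **Brick G3 for `Λ = ℤ_p⟦X⟧`.** Wiles' `Frac Λ`-representation with continuous `Λ`-valued entries `a, d, c`, continuous numerator
`x₀ b` and integral products `b(g)c(h)` is `GL₂(Frac Λ)`-conjugate to a continuous framed representation `π : G →ₜ* GL₂(ℤ_p⟦X⟧)`
(product topology). [folklore; Wiles, Invent. Math. 94 (1988) §2.2] -/
theorem exists_framedRep_powerSeries_padicInt {K : Type*} [Field K] [Algebra (PowerSeries ℤ_[p]) K]
    [IsFractionRing (PowerSeries ℤ_[p]) K] {G : Type*} [Group G] [TopologicalSpace G] [IsTopologicalGroup G]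
    (ρ : G →* Matrix (Fin 2) (Fin 2) K) (x₀ : PowerSeries ℤ_[p]) (hx₀ : x₀ ≠ 0) (a d c b' : G → PowerSeries ℤ_[p])
    (ha : ∀ g, ρ g 0 0 = algebraMap _ K (a g)) (hd : ∀ g, ρ g 1 1 = algebraMap _ K (d g))
    (hc : ∀ g, ρ g 1 0 = algebraMap _ K (c g)) (hb' : ∀ g, algebraMap _ K x₀ * ρ g 0 1 = algebraMap _ K (b' g))
    (hx : ∀ g h, ∃ r : PowerSeries ℤ_[p], ρ g 0 1 * ρ h 1 0 = algebraMap _ K r)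
    (ha_c : Continuous a) (hd_c : Continuous d) (hc_c : Continuous c) (hb'_c : Continuous b') :
    ∃ (π : FramedRep G (PowerSeries ℤ_[p]) 2) (U : (Matrix (Fin 2) (Fin 2) K)ˣ),
      ∀ g, ((π g : GL (Fin 2) (PowerSeries ℤ_[p])) : Matrix (Fin 2) (Fin 2) (PowerSeries ℤ_[p])).map (algebraMap _ K) =
        (↑U⁻¹ : Matrix (Fin 2) (Fin 2) K) * ρ g * (U : Matrix (Fin 2) (Fin 2) K) := by
  haveI : CompactSpace (PowerSeries ℤ_[p]) := TelescopeBranchTraceInterpolation.compactSpace_powerSeries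
  exact exists_framedRep_of_rep_fractionRing free_dual_ideal_powerSeries_padicInt ρ x₀ hx₀ a d c b' ha hd hc hb' hx
    ha_c hd_c hc_c hb'_c

end PadicInt

end Summit.BirchSwinnertonDyer.BirchSwinnertonDyer.Theorems.TelescopeBranchIntegralFrame
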